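import Summits.CriticalPhenomena.SAWScalingLimit.Theorems.SAWLeftRightFKGLeftRightFKGReduction
import HarnessLib

/-!
# Negative knowledge on crux `LeftRightFKG`, part 13: the INSTANCE-LOCAL reduction "corner blocks ⟹ full
positive association" (certified-compute lane, gen 2)

Crux `stmt-CriticalPhenomena-11232` (`Summit.CriticalPhenomena.SAWScalingLimit.Theses.SAWLeftRightFKG.LeftRightFKG`).
The line `corner-localisation` proved the GLOBAL reduction `Corner x → PA x` (`CornerLoc.pa_of_corner`: corner
positivity for ALL crux instances gives positive association for all of them).  A finite certificate can only ever
deliver corner positivity for ONE instance `(C, δ, a, b)`; this file records that the reduction is in fact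
instance-local, by re-assembling the landed instance-local inductions:

* `EndpointMonotone.bi_of_corner` (Esary–Proschan–Walkup induction inside one finite chord type; its inputs — the
  lens dichotomy `hD`, the step rankings `hRN`, `hRP` — are supplied for every crux instance by the landed stubs
  `stub_lensDichotomy` and `stub_stepMonotone stub_meshReduction stub_loopWindVanish`);
* `Chebyshev.bi_of_endMono` (Harris induction inside one finite chord type).

Results (fugacity-blind, `x > 0`):

* **`pa_inst_of_cornerBlock`**: for a crux instance `(δ, C, a, b, a', b')` (`IsInst`), corner positivity of its chord
  type in real block form (hypothesis `hC`, verbatim the `hC` of `bi_of_corner`: for every prefix/suffix class, every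
  step restriction, every next-step-determined relative up-set `A` and previous-step-determined relative up-set `B`,
  `Z(Γ∩A) Z(Γ∩B) ≤ Z(Γ) Z(Γ∩A∩B)`, `Z(S) = Σ_{γ∈S} x^{|γ|}`) implies `μ(A) μ(B) ≤ μ(univ) μ(A ∩ B)` for ALL `≼`-up-closed `A`, `B` (`μ = μx x`, the fugacity-`x` chord measure);
* **`weight_pa_inst_of_cornerBlock`**: the same at `x = x_c`, i.e. for the crux's `SAW.weight` — the conclusion of
  `LeftRightFKG` for that instance.

This is the landing pad of the kernel-checked full-PA certificates of this lane (`PAKit*.lean`, `PACert*.lean`):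
they establish the hypothesis `hC` for `(dom C 1, a, b)` on a fugacity window by exact enumeration.  Elementary ("folklore").
-/

noncomputable section

open MeasureTheory Finset
open Literature.Probability.LatticeModels Literature.Probability.RandomPlanarGeometry
open scoped Classical ENNReal

namespace Summit.CriticalPhenomena.SAWScalingLimit.Theorems.LeftRightFKG.CornerLoc


/-- **Corner blocks of ONE crux instance give its full left–right positive association** (instance-local form of
`pa_of_corner`, fugacity-blind): for a crux instance `(δ, C, a, b, a', b')` and `x > 0`, the corner blocks `hC` of its
chord type imply `μ(A) μ(B) ≤ μ(univ) μ(A ∩ B)` for all `≼`-up-closed `A`, `B`, `μ = μx x`.  Proof: the step rankings and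
finiteness from `stub_stepMonotone stub_meshReduction stub_loopWindVanish`, the lens dichotomy from
`stub_lensDichotomy`, then `bi_of_corner` (corner ⟹ one-ended monotonicity) and `bi_of_endMono` (⟹ PA) inside the
finite chord type, read back through the dictionary `μx_bi_iff`. [cite: EsaryProschanWalkup1967, Theorem 2.1] -/
theorem pa_inst_of_cornerBlock {x : ℝ} (hx : 0 < x) {δ : ℝ} {c a b a' b' : Site 2}
    {C : (zdGraph 2).Walk c c} (hI : IsInst δ a b a' b' C) [Fintype (SAW.DomainSAW (dom C δ) δ a b)]
    (hC : ∀ (k : ℕ) (π : ℕ → Site 2) (m : ℕ) (σ : ℕ → Site 2) (Sa Sb : Set (Site 2))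
      (A B : Set (SAW.DomainSAW (dom C δ) δ a b)) (s : Finset (SAW.DomainSAW (dom C δ) δ a b)),
      s = univ.filter (· ∈ restrP k π m σ Sa Sb) → IsUpOn (cls k π m σ) A →
      IsUpOn (cls k π m σ) B → NextDet k A → PrevDet m B →
      (∑ γ ∈ s.filter (· ∈ A), x ^ γ.length) * (∑ γ ∈ s.filter (· ∈ B), x ^ γ.length) ≤
        (∑ γ ∈ s, x ^ γ.length) * ∑ γ ∈ (s.filter (· ∈ A)).filter (· ∈ B), x ^ γ.length)
    (A B : Set (SAW.DomainSAW (dom C δ) δ a b)) (hA : IsUp A) (hB : IsUp B) :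
    μx x (dom C δ) δ a b A * μx x (dom C δ) δ a b B ≤
      μx x (dom C δ) δ a b Set.univ * μx x (dom C δ) δ a b (A ∩ B) := by
  obtain ⟨-, hRN, hRP⟩ := stub_stepMonotone stub_meshReduction stub_loopWindVanish δ c a b a' b' C hI
  have hD := stub_lensDichotomy δ c a b a' b' C hI
  have key := EndpointMonotone.bi_of_corner hx hD hRN hRP hC
  have hE : ∀ (k : ℕ) (π : ℕ → Site 2) (m : ℕ) (σ : ℕ → Site 2) (Sa Sb : Set (Site 2))
      (E U : Set (SAW.DomainSAW (dom C δ) δ a b)) (s : Finset (SAW.DomainSAW (dom C δ) δ a b)),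
      s = univ.filter (· ∈ restrP k π m σ Sa Sb) → IsUpOn (cls k π m σ) E →
      IsUpOn (cls k π m σ) U → NextDet k E →
      (∑ γ ∈ s.filter (· ∈ E), x ^ γ.length) * (∑ γ ∈ s.filter (· ∈ U), x ^ γ.length) ≤
        (∑ γ ∈ s, x ^ γ.length) * ∑ γ ∈ (s.filter (· ∈ E)).filter (· ∈ U), x ^ γ.length :=
    fun k π m σ Sa Sb E U s hs hEu hU hN => (key _ k π m σ Sa Sb s hs rfl).1 E U hEu hU hN
  have hPA := Chebyshev.bi_of_endMono hx hRN hE _ 0 (fun _ => a) 0 (fun _ => b) Set.univ Set.univ _ rfl rfl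
    A B (isUpOn_of_isUp hA) (isUpOn_of_isUp hB)
  have h := (EndpointMonotone.μx_bi_iff hx.le A B (restrP 0 (fun _ => a) 0 (fun _ => b) Set.univ Set.univ)).2 hPA
  simpa only [restrP_zero_univ, Set.inter_univ] using h

/-- **The same for the crux's own measure** `SAW.weight = μx x_c`: corner blocks at `x_c` of one crux instance give
the conclusion of `LeftRightFKG` for that instance — `w(A) w(B) ≤ w(univ) w(A ∩ B)` for all `≼`-up-closed `A`, `B`.
[cite: EsaryProschanWalkup1967, Theorem 2.1] -/
theorem weight_pa_inst_of_cornerBlock {δ : ℝ} {c a b a' b' : Site 2} {C : (zdGraph 2).Walk c c}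
    (hI : IsInst δ a b a' b' C) [Fintype (SAW.DomainSAW (dom C δ) δ a b)]
    (hC : ∀ (k : ℕ) (π : ℕ → Site 2) (m : ℕ) (σ : ℕ → Site 2) (Sa Sb : Set (Site 2))
      (A B : Set (SAW.DomainSAW (dom C δ) δ a b)) (s : Finset (SAW.DomainSAW (dom C δ) δ a b)),
      s = univ.filter (· ∈ restrP k π m σ Sa Sb) → IsUpOn (cls k π m σ) A →
      IsUpOn (cls k π m σ) B → NextDet k A → PrevDet m B →
      (∑ γ ∈ s.filter (· ∈ A), SAW.criticalFugacity ^ γ.length) * (∑ γ ∈ s.filter (· ∈ B), SAW.criticalFugacity ^ γ.length) ≤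
        (∑ γ ∈ s, SAW.criticalFugacity ^ γ.length) * ∑ γ ∈ (s.filter (· ∈ A)).filter (· ∈ B), SAW.criticalFugacity ^ γ.length)
    (A B : Set (SAW.DomainSAW (dom C δ) δ a b)) (hA : IsUp A) (hB : IsUp B) :
    SAW.weight (dom C δ) δ a b A * SAW.weight (dom C δ) δ a b B ≤
      SAW.weight (dom C δ) δ a b Set.univ * SAW.weight (dom C δ) δ a b (A ∩ B) := by
  simpa only [weight_eq_μx] using pa_inst_of_cornerBlock SAW.criticalFugacity_pos_lt_one'.1 hI hC A B hA hB

end Summit.CriticalPhenomena.SAWScalingLimit.Theorems.LeftRightFKG.CornerLoc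

end
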